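import Summits.HodgeConjecture.HodgeConjecture.Theorems.VHCAbelianSchemesRoadTwistedCarrierPrime
import Literature.AlgebraicGeometry.HodgeTheory.ExpTwistClassesExponentialLaw
import HarnessLib

/-!
# Road b02 (`VHCAbelianSchemesRoad`, D-0059) — MARKMAN'S NORMALISATION LOSES NOTHING: the gauge of the primed door's
# degree-one side, and the equivalence «primed Buchweitz–Flenner datum with `ch₀ ∈ ℚ^×·1` ⟺ Markman-form datum»

research route conditional on HC_CM; not a corollary; Q11.4-sentence-2 already refuted in dim ≥ 3.

FACT-FREE, 0 `def`, 0 named fact, `HC_CM` nowhere; helper for the deciding crux `SemiregularSheafRepresentativesTwPrimeAtDiag`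
(item stmt-HodgeConjecture-20707; skeleton v3.3, stubs 2a‴/2b‴ at `(6,3)` over the primed door `tw(C, AdmTw')`) — ring2-b06 gen 123
(lane «kernel ∕ sugar»), TYPING the hand computation of ring2-b03 gen 85's `PRIMED-BF-CARRIERS-g85.md` §3a («Markman's normalisation
loses nothing … typing it needs an `e^{B+B'}` law for `expTwistClasses`, left to a consumer»). The exponential law itself is the
Literature file `Literature/AlgebraicGeometry/HodgeTheory/ExpTwistClassesExponentialLaw.lean` (`expTwistClasses_add`, untwisting,
ray stability `exists_expTwistClasses_smul_onRay`); this file draws the consequences in the binders of ring2-b03 g85's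
`VHCAbelianSchemesRoadTwistedCarrierPrime` (§4 there: `expTwistCh_one_of_ch_zero`, `expTwistCh_one_markman_eq_zero`,
`isRationalClass_markmanBField`, `markmanBField_mem_algebraicClasses`, `anchoredCarrierAt_twisted_of_forall_exists_markman`).

* §1 THE GAUGE. `markmanBField_eq_smul_add_of_expTwistCh_one`: `ch₀(F) = r·1`, `r ≠ 0`, `(e^{B₀} ch F)₁ = c₁·θ` ⟹
  `B_M := −ch₁(F)/r = (−c₁/r)·θ + B₀` — the degree-one side of the primed door fixes the `B`-field up to the polarisation ray;
  `expTwistCh_markman_eq_expTwistClasses_smul`: `κ_q(F) = (e^{(−c₁/r)θ} ∪ e^{B₀} ch F)_q` in every degree (exponential law);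
  **`exists_markman_sides_of_sides`**: if `(e^{B₀} ch F)_q ∈ ℂθ^q` for `1 ≤ q < p` and `(e^{B₀} ch F)_p = a·w + c_p θᵖ` (`p ≥ 2`), then
  Markman's `κ_q(F) ∈ ℂθ^q` for all `q < p` and `κ_p(F) = a·w + c'_p θᵖ` with THE SAME `a` (ray stability). At `(6,3)`:
  `κ₂^{B_M} = (c₂ − rλ²/2)θ²`, `κ₃^{B_M} = a·w + c₃'θ³` for `B₀ = B_M + λθ` — b03's two bullet lines, now in all `(n, p)`.
* §2 IN THE BINDERS. `forall_exists_markman_of_forall_exists_sides_of_rank`: the hypotheses of b03's `I = {1,…,p}` primed constructor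
  PLUS a rank `ch₀(F) = r·1`, `r ∈ ℚ^×`, give the hypotheses of b03's Markman-normalised constructor (same `F`, same `a`, any side
  predicate `S` on the sheaf, e.g. `{0,…,p−1}`-semiregularity); **`exists_sides_iff_exists_markman`**: anchor by anchor, on a smooth
  projective `X`, «∃ `F` of rank `r ∈ ℚ^×`, `S F`, and a rational algebraic `B₀` paying all primed sides» ⟺ «∃ `F` of rank `r ∈ ℚ^×`,
  `S F`, whose Markman classes pay them» — so the lane-R find-the-sheaf problem at the primed door IS, for sheaves of non-zero
  rank, the Markman-form problem «`{0,…,p−1}`-semiregular `F`, `κ_q(F) ∈ ℂθ^q` (`2 ≤ q < p`), `κ_p(F) ∈ ℂ^×·w + ℂθᵖ`».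

HONEST READING. (i) The rank hypothesis is real: for `F` with `ch₀(F) = 0` there is no Markman class, and a primed datum with such
an `F` can exist only when the served class is on the ray modulo the `B₀`-twist — the anchored-carrier statements serve classes
OFF the ray, but nothing here excludes rank-`0` data formally. (ii) Sides in degrees `q > p` (data on index sets `I ∌` only
`{1,…,p}`) are NOT preserved by the renormalisation (`θ^{q−p} ∪ a·w` enters) — the equivalence is for the `I = {1, …, p}` form, which
is the form of both b03 constructors. (iii) Nothing here says any carrier statement, cell, rung, crux, VHC, `HC_AV` or HC holds.
References: [cite: Markman2025SecantWeil, §1.1 (κ-class), §7.3 and Lemma 9.3.6] [cite: HuybrechtsStellari2005, §1]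
[cite: BuchweitzFlenner2003, §5 (I-semiregular) and Thm. 5.1] [cite: Fulton1998, Prop. 19.1.2 and Cor. 19.2 (b)].
-/

noncomputable section

open CategoryTheory CategoryTheory.Limits AlgebraicGeometry Topology

-- the cell's namespace repeats the summit name (`Summit.HodgeConjecture.HodgeConjecture…`), as in every `Ring2*` file
set_option linter.dupNamespace false

namespace Summit.HodgeConjecture.HodgeConjecture.Ring2.SemiregularRepresentatives

open Literature.AlgebraicGeometry Literature.AlgebraicGeometry.Motives Literature.AlgebraicGeometry.Modules
open Literature.AlgebraicGeometry.HodgeTheory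
open Literature.AlgebraicTopology.SingularHomology

/-! ## §1 The gauge of the degree-one side: `B₀ = B_M + (c₁/r)·θ` -/

section Gauge

variable (C : ChernCharacterBetti) {X : SchemeOver ℂ}

/-- **THE DEGREE-ONE SIDE FIXES THE `B`-FIELD UP TO THE `θ`-RAY**: if `ch₀(F) = r·1`, `r ≠ 0`, and `(e^{B₀} ch F)₁ = c₁·θ`, then
`B₀ = B_M + (c₁/r)·θ` with Markman's `B_M := −ch₁(F)/r`, i.e. `B_M = (−c₁/r)·θ + B₀` (from `(e^{B₀} ch F)₁ = ch₁ + r·B₀`). The gauge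
freedom left by the primed door's degree-one side condition is exactly the polarisation ray. [cite: Markman2025SecantWeil, §1.1 and §7.3]
[cite: HuybrechtsStellari2005, §1] -/
theorem markmanBField_eq_smul_add_of_expTwistCh_one (F : X.left.Modules) {r : ℂ} (hr : r ≠ 0)
    (h0 : C.ch X F 0 = r • singularCohomology.one ℂ (ComplexPoints X)) {B₀ θ : complexBetti X 2} {c₁ : ℂ}
    (h1 : expTwistCh C X B₀ F 1 = c₁ • θ) :
    -(r⁻¹ • C.ch X F 1) = (-(r⁻¹ * c₁)) • θ + B₀ := by
  have h : C.ch X F 1 = c₁ • θ - r • B₀ := by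
    rw [eq_sub_iff_add_eq, ← expTwistCh_one_of_ch_zero C B₀ F h0, h1]
  rw [h, smul_sub, smul_smul, smul_smul, inv_mul_cancel₀ hr, one_smul, neg_sub, neg_smul, sub_eq_neg_add]

/-- **MARKMAN'S CLASS IS THE RAY-TWIST OF ANY PRIMED DATUM'S CLASS**: under the same hypotheses, in every degree `q`,
`κ_q(F) := (e^{B_M} ch F)_q = (e^{(−c₁/r)θ} ∪ (e^{B₀} ch F))_q` (exponential law `expTwistClasses_add`).
[cite: Markman2025SecantWeil, §1.1 and §7.3] [cite: HuybrechtsStellari2005, §1] -/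
theorem expTwistCh_markman_eq_expTwistClasses_smul (F : X.left.Modules) {r : ℂ} (hr : r ≠ 0)
    (h0 : C.ch X F 0 = r • singularCohomology.one ℂ (ComplexPoints X)) {B₀ θ : complexBetti X 2} {c₁ : ℂ}
    (h1 : expTwistCh C X B₀ F 1 = c₁ • θ) (q : ℕ) :
    expTwistCh C X (-(r⁻¹ • C.ch X F 1)) F q =
      expTwistClasses X ((-(r⁻¹ * c₁)) • θ) (fun j => expTwistCh C X B₀ F j) q := by
  rw [expTwistCh_eq_expTwistClasses, expTwistClasses_eq_expTwistClasses_sub X B₀ (-(r⁻¹ • C.ch X F 1)) (fun j => C.ch X F j) q,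
    markmanBField_eq_smul_add_of_expTwistCh_one C F hr h0 h1, add_sub_cancel_right]
  rfl

/-- **MARKMAN'S NORMALISATION LOSES NOTHING (sheaf level).** Let `ch₀(F) = r·1` with `r ≠ 0`, `p ≥ 2`, and let `B₀` be ANY
`B`-field whose twisted classes pay the primed door's price at `(X, θ, w)`: `(e^{B₀} ch F)_q = c_q·θ^q` for `1 ≤ q < p` and
`(e^{B₀} ch F)_p = a·w + c_p·θᵖ`. Then Markman's classes `κ_q(F) = (e^{−ch₁(F)/r} ch F)_q` pay it too: `κ_q(F) = c'_q·θ^q` for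
ALL `q < p` (with `c'_0 = r`, `c'_1 = 0`) and `κ_p(F) = a·w + c'_p·θᵖ` with THE SAME `a` — so at `(6,3)` (and every `(n,p)`,
`p ≥ 2`) a primed Buchweitz–Flenner datum with `ch₀ ∈ ℂ^×·1` exists iff a Markman-form one does (`§2`). Proof: `B₀ = B_M + (c₁/r)θ`
(degree one), the exponential law, and ray stability of the twist by a multiple of `θ` (`exists_expTwistClasses_smul_onRay`).
[cite: Markman2025SecantWeil, §1.1, §7.3 and Lemma 9.3.6] [cite: HuybrechtsStellari2005, §1] -/
theorem exists_markman_sides_of_sides (F : X.left.Modules) {r : ℂ} (hr : r ≠ 0)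
    (h0 : C.ch X F 0 = r • singularCohomology.one ℂ (ComplexPoints X)) {B₀ θ : complexBetti X 2} {p : ℕ} (hp : 2 ≤ p)
    {w : complexBetti X (2 * p)} {a : ℂ} (c : ℕ → ℂ) (hκp : expTwistCh C X B₀ F p = a • w + c p • cupPowTwo θ p)
    (hκq : ∀ q, 1 ≤ q → q < p → expTwistCh C X B₀ F q = c q • cupPowTwo θ q) :
    ∃ c' : ℕ → ℂ, expTwistCh C X (-(r⁻¹ • C.ch X F 1)) F p = a • w + c' p • cupPowTwo θ p ∧
      ∀ q < p, expTwistCh C X (-(r⁻¹ • C.ch X F 1)) F q = c' q • cupPowTwo θ q := by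
  have h1 : expTwistCh C X B₀ F 1 = c 1 • θ := by
    rw [hκq 1 le_rfl (by omega), cupPowTwo_one]
  -- all classes `(e^{B₀} ch F)_q`, `q < p`, are on the ray (degree `0`: `ch₀ = r·1 = r·θ⁰`)
  have hray : ∀ q < p, expTwistCh C X B₀ F q = (fun q => if q = 0 then r else c q) q • cupPowTwo θ q := by
    intro q hq
    dsimp only
    rcases Nat.eq_zero_or_pos q with rfl | hq0
    · -- degree `0`: `(e^{B₀} ch F)₀ = ch₀(F) = r·1 = r·θ⁰` (the single term `B₀⁰ ∪ ch₀ = 1 ∪ ch₀`)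
      rw [if_pos rfl, expTwistCh_eq_expTwistClasses, cupPowTwo_zero, ← h0]
      unfold expTwistClasses
      rw [Fin.sum_univ_one]
      change ((Nat.factorial 0 : ℕ) : ℂ)⁻¹ • cupProduct _ (cupPowTwo B₀ 0) (C.ch X F 0) = C.ch X F 0
      rw [Nat.factorial_zero, Nat.cast_one, inv_one, one_smul, cupPowTwo_zero]
      exact one_cupProduct _
    · rw [if_neg (by omega)]
      exact hκq q hq0 hq
  obtain ⟨c', hc'q, hc'p⟩ := exists_expTwistClasses_smul_onRay X (-(r⁻¹ * c 1)) _ hray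
  refine ⟨fun q => if q = p then c p + c' p else c' q, ?_, fun q hq => ?_⟩
  · dsimp only
    rw [if_pos rfl, expTwistCh_markman_eq_expTwistClasses_smul C F hr h0 h1, hc'p, add_smul, ← add_assoc]
    exact congrArg (· + c' p • cupPowTwo θ p) hκp
  · dsimp only
    rw [if_neg (by omega), expTwistCh_markman_eq_expTwistClasses_smul C F hr h0 h1]
    exact hc'q q hq

end Gauge

/-! ## §2 Consequences in the binders of the primed constructors: primed BF data with `ch₀ ∈ ℚ^×·1` ⟺ Markman-form data -/

section Binders

variable {C : ChernCharacterBetti} {n p : ℕ} {𝔄 : ∀ X : SchemeOver ℂ, complexBetti X 2 → Prop}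
  {𝔖 : ∀ (X : SchemeOver ℂ), complexBetti X 2 → Set (complexBetti X (2 * p))}

/-- **THE CONVERSE OF `anchoredCarrierAt_twisted_of_forall_exists_markman`, AT THE LEVEL OF ITS BINDERS** (`p ≥ 2`): the sheaf
data of the `I = {1, …, p}` primed constructor `anchoredCarrierAt_twisted_of_forall_exists_isISemiregular_Icc` — any rational
algebraic `B₀`, ALL lower sides `(e^{B₀} ch F)_q = c_q·θ^q` (`1 ≤ q < p`), `(e^{B₀} ch F)_p = a·w + c_p·θᵖ` — TOGETHER WITH A RANK
`ch₀(F) = r·1`, `r ∈ ℚ^×`, yield the Markman-form data (`κ_q(F) ∈ ℂθ^q` for `2 ≤ q < p`, `κ_p(F) = a·w + c·θᵖ`, same `F`, same `a`,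
same semiregularity). Hence, for sheaves of non-zero rational rank, the two constructors have EQUIVALENT hypotheses: the
Markman-normalised find-the-sheaf problem of lane R at `(6,3)` («`{0,1,2}`-semiregular `F`, `κ₂(F) ∈ ℂθ²`,
`κ₃(F) ∈ ℂ^×·w + ℂθ³`») is not a special case but THE case. [cite: Markman2025SecantWeil, §1.1, §7.3 and Lemma 9.3.6]
[cite: BuchweitzFlenner2003, §5 (I-semiregular) and Thm. 5.1] [cite: HuybrechtsStellari2005, §1] -/
theorem forall_exists_markman_of_forall_exists_sides_of_rank (hp : 2 ≤ p) {S : ∀ (X : SchemeOver ℂ) (F : X.left.Modules), IsFiniteLocallyFree F → Prop}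
    (h : ∀ (X : SchemeOver ℂ) (θ : complexBetti X 2), 𝔄 X θ → ∀ w ∈ 𝔖 X θ, IsRationalClass w →
      ∃ (F : X.left.Modules) (hF : IsFiniteLocallyFree F) (r : ℚ) (B₀ : complexBetti X 2) (a : ℂ) (c : ℕ → ℂ),
        r ≠ 0 ∧ C.ch X F 0 = (r : ℂ) • singularCohomology.one ℂ (ComplexPoints X) ∧ S X F hF ∧ a ≠ 0 ∧
        expTwistCh C X B₀ F p = a • w + c p • cupPowTwo θ p ∧ ∀ q, 1 ≤ q → q < p → expTwistCh C X B₀ F q = c q • cupPowTwo θ q) :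
    ∀ (X : SchemeOver ℂ) (θ : complexBetti X 2), 𝔄 X θ → ∀ w ∈ 𝔖 X θ, IsRationalClass w →
      ∃ (F : X.left.Modules) (hF : IsFiniteLocallyFree F) (r : ℚ) (a : ℂ) (c : ℕ → ℂ),
        r ≠ 0 ∧ C.ch X F 0 = (r : ℂ) • singularCohomology.one ℂ (ComplexPoints X) ∧ S X F hF ∧ a ≠ 0 ∧
        expTwistCh C X (-(((r : ℂ))⁻¹ • C.ch X F 1)) F p = a • w + c p • cupPowTwo θ p ∧
        ∀ q, 2 ≤ q → q < p → expTwistCh C X (-(((r : ℂ))⁻¹ • C.ch X F 1)) F q = c q • cupPowTwo θ q := by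
  intro X θ hXθ w hw hwQ
  obtain ⟨F, hF, r, B₀, a, c, hr, h0, hS, ha, hκp, hκq⟩ := h X θ hXθ w hw hwQ
  obtain ⟨c', hp', hq'⟩ := exists_markman_sides_of_sides C F (by exact_mod_cast hr) h0 hp c hκp hκq
  exact ⟨F, hF, r, a, c', hr, h0, hS, ha, hp', fun q _ hqp => hq' q hqp⟩

/-- **PRIMED BF DATA WITH `ch₀ ∈ ℚ^×·1` ⟺ MARKMAN-FORM DATA, anchor by anchor** (`p ≥ 2`, `X` smooth projective of dimension
`N`, any side predicate `S` on the sheaf — e.g. `{0,…,p−1}`-semiregularity): at `(X, θ, w)` there is a finite locally free `F`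
of rank `r ∈ ℚ^×` with a RATIONAL ALGEBRAIC `B`-field `B₀` paying all the primed door's sides (`(e^{B₀} ch F)_q ∈ ℂθ^q`,
`1 ≤ q < p`; `(e^{B₀} ch F)_p = a·w + c·θᵖ`, `a ≠ 0`) IF AND ONLY IF there is such an `F` whose MARKMAN classes
`κ(F) = ch(F)·e^{−ch₁(F)/r}` do (`κ_q(F) ∈ ℂθ^q`, `2 ≤ q < p`; `κ_p(F) = a·w + c·θᵖ`, `a ≠ 0`) — ⟸ is Markman's normalisation
(`B₀ := −ch₁/r` is rational and algebraic, `κ₁ = 0`; ring2-b03 g85 §4), ⟹ is `exists_markman_sides_of_sides`.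
[cite: Markman2025SecantWeil, §1.1, §7.3 and Lemma 9.3.6] [cite: HuybrechtsStellari2005, §1] [cite: Fulton1998, Prop. 19.1.2 and Cor. 19.2 (b)] -/
theorem exists_sides_iff_exists_markman {N : ℕ} {X : SchemeOver ℂ} (hX : IsSmoothProjective N X) (hp : 2 ≤ p)
    (S : ∀ F : X.left.Modules, IsFiniteLocallyFree F → Prop) (θ : complexBetti X 2) (w : complexBetti X (2 * p)) :
    (∃ (F : X.left.Modules) (hF : IsFiniteLocallyFree F) (r : ℚ) (B₀ : complexBetti X 2) (a : ℂ) (c : ℕ → ℂ),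
        r ≠ 0 ∧ C.ch X F 0 = (r : ℂ) • singularCohomology.one ℂ (ComplexPoints X) ∧ S F hF ∧
        IsRationalClass B₀ ∧ B₀ ∈ algebraicClasses X 1 ∧ a ≠ 0 ∧
        expTwistCh C X B₀ F p = a • w + c p • cupPowTwo θ p ∧ ∀ q, 1 ≤ q → q < p → expTwistCh C X B₀ F q = c q • cupPowTwo θ q) ↔
    ∃ (F : X.left.Modules) (hF : IsFiniteLocallyFree F) (r : ℚ) (a : ℂ) (c : ℕ → ℂ),
        r ≠ 0 ∧ C.ch X F 0 = (r : ℂ) • singularCohomology.one ℂ (ComplexPoints X) ∧ S F hF ∧ a ≠ 0 ∧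
        expTwistCh C X (-(((r : ℂ))⁻¹ • C.ch X F 1)) F p = a • w + c p • cupPowTwo θ p ∧
        ∀ q, 2 ≤ q → q < p → expTwistCh C X (-(((r : ℂ))⁻¹ • C.ch X F 1)) F q = c q • cupPowTwo θ q := by
  constructor
  · rintro ⟨F, hF, r, B₀, a, c, hr, h0, hS, -, -, ha, hκp, hκq⟩
    obtain ⟨c', hp', hq'⟩ := exists_markman_sides_of_sides C F (by exact_mod_cast hr) h0 hp c hκp hκq
    exact ⟨F, hF, r, a, c', hr, h0, hS, ha, hp', fun q _ hqp => hq' q hqp⟩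
  · rintro ⟨F, hF, r, a, c, hr, h0, hS, ha, hκp, hκq⟩
    refine ⟨F, hF, r, -(((r : ℂ))⁻¹ • C.ch X F 1), a, fun q => if q = 1 then 0 else c q, hr, h0, hS,
      isRationalClass_markmanBField C F hF r, markmanBField_mem_algebraicClasses C hX F hF _, ha, ?_, fun q h1 hqp => ?_⟩
    · dsimp only
      rw [if_neg (show p ≠ 1 by omega)]
      exact hκp
    · rcases Nat.eq_or_lt_of_le h1 with h1 | h1
      · subst h1
        dsimp only
        rw [if_pos rfl, zero_smul]
        exact expTwistCh_one_markman_eq_zero C F (by exact_mod_cast hr) h0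
      · dsimp only
        rw [if_neg (show q ≠ 1 by omega)]
        exact hκq q h1 hqp

end Binders

end Summit.HodgeConjecture.HodgeConjecture.Ring2.SemiregularRepresentatives

end
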